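import Mathlib
import HarnessLib
import Literature.MathematicalPhysics.QuantumFieldTheory.ConstructiveQFTWave0
import Summits.Ventures.LatticeQCDFlow.Scaling.ConjecturesRepaired
import Summits.Ventures.LatticeQCDFlow.Scaling.ExactTransportUN

/-!
# LatticeQCDFlow / Scaling — (C2a-R) for `U(N)`, `N ≥ 2`, `d ≥ 2` (v2.5)

HONEST FRAMING: exact (Metropolis-corrected) sampling algorithms for lattice gauge theory; figures
of merit are autocorrelation/cost numbers at stated couplings and volumes; no continuum-physics
claim.

Venture `LatticeQCDFlow` (cell pub-lqcd), topic `Scaling`, FANOUT row 29 (theory2) — OUR WORK.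
The repaired conjecture item `Conjectures.ExactTransportBiLipschitzR` (volumes `L ≥ 2` only,
`Scaling/ConjecturesRepaired.lean`) holds for the unitary group `𝔾 N = unitaryGroup (Fin N) ℂ`,
`N ≥ 2`, `d ≥ 2`, with the Hilbert–Schmidt metric — a one-line consequence of row 30's
unrepaired theorem `UN.exactTransportBiLipschitz` (`Scaling/ExactTransportUN.lean`, all
`L ≥ 1`).  The case `N = 1` (where the unrepaired statement is FALSE at `L = 1`,
`Scaling/ExactTransportDegenerate.lean`) is NOT covered here: it needs the `L ≥ 2` form of the
transport theorem together with `UN.extensive_action_R` (`Scaling/ExtensiveActionInstances.lean`).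
Nothing is cited as a fact.
-/

namespace Summit.Ventures.LatticeQCDFlow.Theory2.Lattice.UN

open scoped Matrix.Norms.Frobenius
open MeasureTheory Literature.MathematicalPhysics.QuantumFieldTheory
  Literature.MathematicalPhysics.QuantumFieldTheory.UnitaryCayley
  Literature.MathematicalPhysics.QuantumLattice

/-- **(C2a-R) for `U(N)`, `N ≥ 2`, `d ≥ 2`, Hilbert–Schmidt metric** — from row 30's unrepaired
theorem `UN.exactTransportBiLipschitz`. [folklore] -/
theorem exactTransportBiLipschitzR (d N : ℕ) (hd : 2 ≤ d) (hN : 2 ≤ N) :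
    @Conjectures.ExactTransportBiLipschitzR d N (𝔾 N) _ Subtype.metricSpace isTopologicalGroup_hs
      compactSpace_hs _ borelSpace_hs (unitaryFundamentalRep (Fin N) ℂ) :=
  @Conjectures.exactTransportBiLipschitzR_of d N (𝔾 N) _ Subtype.metricSpace
    isTopologicalGroup_hs compactSpace_hs _ borelSpace_hs (unitaryFundamentalRep (Fin N) ℂ)
    (exactTransportBiLipschitz d N hd hN)

end Summit.Ventures.LatticeQCDFlow.Theory2.Lattice.UN
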